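import Summits.Schanuel.Schanuel.Theorems.ZilberEacRelationPuiseux
import Summits.Schanuel.Schanuel.Theorems.ZilberEacBoundedBranchDensity
import HarnessLib

/-!
# Arbitrary base branches, CI: SURFACES WHOSE EQUATIONS INVOLVE `y₁`, OVER A CURVE WITH A
# HORIZONTAL ASYMPTOTE — Mantova–Masser's question by the bounded engine (O90 (a); no `ℚ̄`)

HONEST FRAMING.  Cell `pub-schanuel` (Zilber's Exponential-Algebraic Closedness, case ladder;
host summit Schanuel), seat 2, gen 33.  All previous verdicts concerned surfaces whose equations
omit `y₁` (fibres and fibre curves in `y₀`, cylinders).  Along a BOUNDED place `x₀ = s^{-k}`,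
`x₁ = Φ(s) → θ` of the base curve the coordinate `y₁ = e^{x₁}` is an analytic function of the
place parameter, so a relation `G(x₀, x₁, y₁; y₀) = 0` has a Puiseux root `y₀ = ψ(σ)σ^L` after the
substitution (file C), and the bounded engine of file LXVII (`unprojectedDense_boundedBranch`,
transcendence, NO direction or `ℚ̄` hypothesis) applies.  Results:
* **`unprojectedDense_relation_boundedPlace`** — `F` irreducible of `x₁`-degree `≥ 2`, a bounded
  place, `G ∈ ℂ[x₀, x₁, y₁][y₀]` of positive `y₀`-degree with top coefficient, bottom coefficient
  and `y₀`-discriminant not divisible by `F`; every irreducible `S` of dimension `≤ 2` containing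
  the points `(x(s), y, e^{x₁(s)})` with `G(x(s), e^{x₁(s)}; y) = 0`, `y ≠ 0`, is dense;
* **`unprojectedDense_relation_of_topRowRoot`** — the global form: a root of the top row of `F`
  (a horizontal asymptote) and `S ⊇ {x ∈ C, c(x, e^{x₁}) ≠ 0, y₀ ≠ 0, G(x, e^{x₁}; y₀) = 0}`;
* example **`unprojectedDense_conic_sqRelation`**: over the conic `x₁² + x₀x₁ + x₀ = 0` every
  irreducible surface of dimension `≤ 2` through the points with `y₀² = y₁ + x₀` (`y₁ = e^{x₁}`)
  is dense — the first decided surface whose equation involves BOTH `y₀` and `y₁`.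
What this is NOT: curves all of whose places are unbounded (`y₁ = e^{Φ(s)s^{-M}}` essentially
singular: Mantova–Masser's exponential-polynomial regime) — OPEN; the `∀ W` form (minimal
polynomial over `ℂ[x₀,x₁,y₁]`) — next; Fib(3,2); EC(3,2) — OPEN; the question OPEN in general;
NOT Schanuel's conjecture (neither used nor implied); EAC ⇏ SC.
-/

noncomputable section

open Filter Topology Set Complex Polynomial
open Literature.NumberTheory.Transcendental Literature.ModelTheory.Zilber
open Literature.ModelTheory.ExponentialFields

set_option linter.dupNamespace false

namespace Summit.Schanuel.Schanuel.Theorems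

section RelationBoundedPlace

variable (F : ℂ[X][X])

/-! ## Part A. Along a bounded place -/

/-- **Relations involving `y₁` along a bounded place: dense.**  See the module docstring.
[cite: MantovaMasser2023, §1 Further remarks, p. 5 (the question, open in general)] (new) -/
theorem unprojectedDense_relation_boundedPlace {S : Set (Fin 2 ⊕ Fin 2 → ℂ)}
    (hS : IsIrreducibleClosed ℂ S) (hdim : zariskiDim ℂ S ≤ (2 : ℕ)) (hFirr : Irreducible F)
    (hn : 2 ≤ F.natDegree) {k : ℕ} (hk : 1 ≤ k) {Φ : ℂ → ℂ} (hΦan : AnalyticAt ℂ Φ 0)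
    (hplace : ∀ᶠ s in 𝓝[≠] (0 : ℂ), (F.map (Polynomial.evalRingHom (s ^ k)⁻¹)).eval (Φ s) = 0)
    (F₃ : MvPolynomial (Fin 3) ℂ)
    (hF₃ : ∀ v : Fin 3 → ℂ, MvPolynomial.eval v F₃ = (F.map (Polynomial.evalRingHom (v 0))).eval (v 1))
    (G : Polynomial (MvPolynomial (Fin 3) ℂ)) (hd : 1 ≤ G.natDegree) (htop : ¬ F₃ ∣ G.leadingCoeff)
    (hbot : ¬ F₃ ∣ G.coeff 0)
    (hdisc : ¬ F₃ ∣ Polynomial.resultant G (derivative G) G.natDegree (G.natDegree - 1))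
    (hsub : ∀ᶠ s in 𝓝[≠] (0 : ℂ), ∀ y : ℂ, y ≠ 0 →
      (G.map (MvPolynomial.eval ![(s ^ k)⁻¹, Φ s, Complex.exp (Φ s)])).eval y = 0 →
      (Sum.elim ![(s ^ k)⁻¹, Φ s] ![y, Complex.exp (Φ s)] : Fin 2 ⊕ Fin 2 → ℂ) ∈ S) :
    UnprojectedDense S := by
  classical
  obtain ⟨e, L, ψ, he, hψan, hψ0, hroot⟩ := exists_relation_puiseuxRoot_boundedPlace F hFirr hn hk
    hΦan hplace F₃ hF₃ G hd htop hbot hdisc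
  have hψne : ∀ᶠ σ in 𝓝 (0 : ℂ), ψ σ ≠ 0 := hψan.continuousAt.eventually_ne hψ0
  have he0 : e ≠ 0 := by omega
  have hpowT : Tendsto (fun σ : ℂ => σ ^ e) (𝓝[≠] (0 : ℂ)) (𝓝[≠] (0 : ℂ)) :=
    tendsto_nhdsWithin_iff.2 ⟨(tendsto_pow_nhds_zero e he).mono_left nhdsWithin_le_nhds,
      eventually_nhdsWithin_of_forall fun σ hσ => pow_ne_zero _ hσ⟩
  have hΦ' : AnalyticAt ℂ (fun σ : ℂ => Φ (σ ^ e)) 0 :=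
    hΦan.comp_of_eq (analyticAt_id.pow e) (by simp [zero_pow he0])
  refine unprojectedDense_boundedBranch F hS hdim hFirr hn (k := e * k) (Nat.mul_pos (by omega)
    (by omega)) hΦ' ?_ L hψan hψ0 ?_
  · filter_upwards [hpowT.eventually hplace] with σ hσ
    rw [pow_mul]
    exact hσ
  · filter_upwards [hpowT.eventually hsub, hroot, nhdsWithin_le_nhds hψne, self_mem_nhdsWithin]
      with σ hσ hr hψσ hσ0
    rw [pow_mul]
    exact hσ _ (mul_ne_zero hψσ (zpow_ne_zero _ hσ0)) hr

/-! ## Part B. The global form: a horizontal asymptote -/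

/-- **Relations involving `y₁` over a curve with a horizontal asymptote: dense.**  `F` irreducible
of `x₁`-degree `≥ 2` whose top row `T` (at the maximal row degree `N`) has a root — a bounded
place exists (file LXXII); `G` as above; `c ∈ ℂ[x₀, x₁, y₁]` with `F₃ ∤ c`; every irreducible `S`
of dimension `≤ 2` containing the points `(x₀, x₁, y, e^{x₁})` with `F(x) = 0`,
`c(x, e^{x₁}) ≠ 0`, `y ≠ 0`, `G(x, e^{x₁}; y) = 0` has Zariski-dense exponential points.
[cite: MantovaMasser2023, §1 Further remarks, p. 5 (the question, open in general)] (new) -/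
theorem unprojectedDense_relation_of_topRowRoot (hFirr : Irreducible F) (hn : 2 ≤ F.natDegree)
    (N : ℕ) (hN : ∀ j, (F.coeff j).natDegree ≤ N) (T : ℂ[X])
    (hT : ∀ j, T.coeff j = (F.coeff j).coeff N) (hT0 : T ≠ 0) {θ : ℂ} (hTθ : T.IsRoot θ)
    (F₃ : MvPolynomial (Fin 3) ℂ)
    (hF₃ : ∀ v : Fin 3 → ℂ, MvPolynomial.eval v F₃ = (F.map (Polynomial.evalRingHom (v 0))).eval (v 1))
    (G : Polynomial (MvPolynomial (Fin 3) ℂ)) (hd : 1 ≤ G.natDegree) (htop : ¬ F₃ ∣ G.leadingCoeff)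
    (hbot : ¬ F₃ ∣ G.coeff 0)
    (hdisc : ¬ F₃ ∣ Polynomial.resultant G (derivative G) G.natDegree (G.natDegree - 1))
    (c : MvPolynomial (Fin 3) ℂ) (hc : ¬ F₃ ∣ c) {S : Set (Fin 2 ⊕ Fin 2 → ℂ)}
    (hS : IsIrreducibleClosed ℂ S) (hdim : zariskiDim ℂ S ≤ (2 : ℕ))
    (hsub : ∀ x₀ x₁ y : ℂ, (F.map (Polynomial.evalRingHom x₀)).eval x₁ = 0 →
      MvPolynomial.eval ![x₀, x₁, Complex.exp x₁] c ≠ 0 → y ≠ 0 →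
      (G.map (MvPolynomial.eval ![x₀, x₁, Complex.exp x₁])).eval y = 0 →
      (Sum.elim ![x₀, x₁] ![y, Complex.exp x₁] : Fin 2 ⊕ Fin 2 → ℂ) ∈ S) :
    UnprojectedDense S := by
  classical
  obtain ⟨k, Φ, hk, hΦan, -, hplace⟩ :=
    exists_fibreCycle_puiseux F hFirr (by omega) N hN T hT hT0 hTθ
  -- `c` does not vanish along the place
  obtain ⟨n, ρ, hρan, hρev⟩ := exists_row_mv_along_boundedPlace F hFirr (by omega) hk hΦan hplace c
  have hρ0 : ¬ ∀ᶠ s in 𝓝 (0 : ℂ), s ^ 0 * ρ s = 0 :=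
    not_eventually_zero_row_mv F hFirr hn hk hΦan hplace F₃ hF₃ hc hρev 0
  have hρne : ∀ᶠ s in 𝓝[≠] (0 : ℂ), ρ s ≠ 0 := by
    rcases hρan.eventually_eq_zero_or_eventually_ne_zero with h | h
    · exact (hρ0 (by filter_upwards [h] with s hs; rw [pow_zero, one_mul, hs])).elim
    · exact h
  refine unprojectedDense_relation_boundedPlace F hS hdim hFirr hn hk hΦan hplace F₃ hF₃ G hd htop
    hbot hdisc ?_
  filter_upwards [hplace, hρev, hρne, self_mem_nhdsWithin] with s hs hcs hρs hs0 y hy0 hy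
  replace hs0 : s ≠ 0 := hs0
  refine hsub _ _ y hs ?_ hy0 hy
  intro h0
  rw [h0, mul_zero] at hcs
  exact hρs hcs.symm

/-! ## Part C. Example: `y₀² = y₁ + x₀` over the conic `x₁² + x₀x₁ + x₀ = 0` -/

/-- The conic `x₁² + x₀x₁ + x₀` evaluated. [folklore] -/
theorem conicE_eval (x y : ℂ) :
    ((X ^ 2 + Polynomial.C (X : ℂ[X]) * X + Polynomial.C (X : ℂ[X]) : ℂ[X][X]).map
        (Polynomial.evalRingHom x)).eval y = y ^ 2 + x * y + x := by
  simp

/-- Its `x₁`-degree. [folklore] -/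
theorem conicE_natDegree :
    (X ^ 2 + Polynomial.C (X : ℂ[X]) * X + Polynomial.C (X : ℂ[X]) : ℂ[X][X]).natDegree = 2 := by
  compute_degree!

/-- Its rows. [folklore] -/
theorem conicE_coeff (j : ℕ) :
    (X ^ 2 + Polynomial.C (X : ℂ[X]) * X + Polynomial.C (X : ℂ[X]) : ℂ[X][X]).coeff j =
      if j = 2 then 1 else if j = 1 then X else if j = 0 then X else 0 := by
  simp only [Polynomial.coeff_add, Polynomial.coeff_X_pow, Polynomial.coeff_C_mul, Polynomial.coeff_X,
    Polynomial.coeff_C]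
  rcases j with _ | _ | _ | j <;> simp

/-- It is monic. [folklore] -/
theorem conicE_monic :
    (X ^ 2 + Polynomial.C (X : ℂ[X]) * X + Polynomial.C (X : ℂ[X]) : ℂ[X][X]).Monic := by
  rw [Polynomial.Monic, Polynomial.leadingCoeff, conicE_natDegree, conicE_coeff]
  simp

/-- `x₁² + x₀x₁ + x₀` is irreducible (Eisenstein at `x₀`; as in file LXVII (b)). [folklore] -/
theorem conicE_irreducible :
    Irreducible (X ^ 2 + Polynomial.C (X : ℂ[X]) * X + Polynomial.C (X : ℂ[X]) : ℂ[X][X]) := by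
  set F : ℂ[X][X] := X ^ 2 + Polynomial.C (X : ℂ[X]) * X + Polynomial.C (X : ℂ[X]) with hF
  have hP : (Ideal.span {(X : ℂ[X])}).IsPrime :=
    (Ideal.span_singleton_prime Polynomial.X_ne_zero).2 Polynomial.prime_X
  have hdeg : F.degree = 2 := by
    rw [Polynomial.degree_eq_natDegree conicE_monic.ne_zero, conicE_natDegree]; rfl
  refine Polynomial.irreducible_of_eisenstein_criterion hP ?_ ?_ ?_ ?_ conicE_monic.isPrimitive
  · rw [conicE_monic.leadingCoeff, Ideal.mem_span_singleton]
    intro h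
    have := Polynomial.natDegree_le_of_dvd h one_ne_zero
    rw [Polynomial.natDegree_X, Polynomial.natDegree_one] at this
    exact Nat.not_succ_le_zero 0 this
  · intro n hn
    rw [hdeg] at hn
    have hn2 : n < 2 := by exact_mod_cast hn
    rw [conicE_coeff, Ideal.mem_span_singleton]
    interval_cases n <;> simp
  · rw [hdeg]; norm_num
  · rw [conicE_coeff, Ideal.span_singleton_pow, Ideal.mem_span_singleton]
    simp only [show ¬ (0 : ℕ) = 2 by norm_num, show ¬ (0 : ℕ) = 1 by norm_num, if_false, if_true]
    intro h
    have := Polynomial.natDegree_le_of_dvd h Polynomial.X_ne_zero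
    rw [Polynomial.natDegree_pow, Polynomial.natDegree_X] at this
    omega

/-- A polynomial `H ∈ ℂ[x₀, x₁, y₁]` is not divisible by the curve polynomial `F₃` as soon as it is
nonzero at some point `(x₀, x₁, t)` with `(x₀, x₁)` on the curve. [folklore] -/
theorem not_dvd_of_eval_ne_zero_mv {F₃ H : MvPolynomial (Fin 3) ℂ}
    (hF₃ : ∀ v : Fin 3 → ℂ, MvPolynomial.eval v F₃ = (F.map (Polynomial.evalRingHom (v 0))).eval (v 1))
    {v : Fin 3 → ℂ} (hv : (F.map (Polynomial.evalRingHom (v 0))).eval (v 1) = 0)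
    (hH : MvPolynomial.eval v H ≠ 0) : ¬ F₃ ∣ H := by
  rintro ⟨Q, rfl⟩
  apply hH
  rw [map_mul, hF₃, hv, zero_mul]

/-- **`y₀² = y₁ + x₀` over the conic `x₁² + x₀x₁ + x₀ = 0`: dense** — every irreducible surface of
dimension `≤ 2` containing the points `(x₀, x₁, y₀, e^{x₁})` with `x₁² + x₀x₁ + x₀ = 0`,
`y₀² = e^{x₁} + x₀` has Zariski-dense exponential points.  (Horizontal asymptote `x₁ → -1`;
`G = y₀² − (y₁ + x₀)`, discriminant `4(y₁ + x₀)`; the points `(0, 0, t)` with `t ≠ 0` witness the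
non-divisibilities.) [cite: MantovaMasser2023, §1 Further remarks, p. 5 (the question, open in
general)] (new) -/
theorem unprojectedDense_conic_sqRelation {S : Set (Fin 2 ⊕ Fin 2 → ℂ)}
    (hS : IsIrreducibleClosed ℂ S) (hdim : zariskiDim ℂ S ≤ (2 : ℕ))
    (hsub : ∀ x₀ x₁ y : ℂ, x₁ ^ 2 + x₀ * x₁ + x₀ = 0 → y ^ 2 = Complex.exp x₁ + x₀ →
      (Sum.elim ![x₀, x₁] ![y, Complex.exp x₁] : Fin 2 ⊕ Fin 2 → ℂ) ∈ S) :
    UnprojectedDense S := by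
  classical
  set Fc : ℂ[X][X] := X ^ 2 + Polynomial.C (X : ℂ[X]) * X + Polynomial.C (X : ℂ[X]) with hFc
  -- the curve inside `ℂ[x₀, x₁, y₁]`
  set F₃ : MvPolynomial (Fin 3) ℂ := MvPolynomial.X 1 ^ 2 + MvPolynomial.X 0 * MvPolynomial.X 1 +
    MvPolynomial.X 0 with hF₃
  have hF₃ev : ∀ v : Fin 3 → ℂ, MvPolynomial.eval v F₃ =
      (Fc.map (Polynomial.evalRingHom (v 0))).eval (v 1) := by
    intro v; rw [hFc, conicE_eval]; simp [hF₃]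
  -- the relation `G = y₀² − (y₁ + x₀)`
  set G : Polynomial (MvPolynomial (Fin 3) ℂ) :=
    Polynomial.X ^ 2 - Polynomial.C (MvPolynomial.X 2 + MvPolynomial.X 0) with hG
  have hGdeg : G.degree = 2 := by rw [hG, Polynomial.degree_X_pow_sub_C (by norm_num)]; rfl
  have hGnat : G.natDegree = 2 := by rw [hG]; exact Polynomial.natDegree_X_pow_sub_C
  have hGev : ∀ (f : MvPolynomial (Fin 3) ℂ →+* ℂ) (y : ℂ), (G.map f).eval y =
      y ^ 2 - f (MvPolynomial.X 2 + MvPolynomial.X 0) := by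
    intro f y
    simp only [hG, Polynomial.map_sub, Polynomial.map_pow, Polynomial.map_X, Polynomial.map_C,
      Polynomial.eval_sub, Polynomial.eval_pow, Polynomial.eval_X, Polynomial.eval_C]
  -- witnesses of non-divisibility at `(0, 0, t)`
  have hpt : ∀ t : ℂ, (Fc.map (Polynomial.evalRingHom ((![0, 0, t] : Fin 3 → ℂ) 0))).eval
      ((![0, 0, t] : Fin 3 → ℂ) 1) = 0 := by
    intro t; rw [conicE_eval]; simp
  have htop : ¬ F₃ ∣ G.leadingCoeff := by
    rw [hG, (Polynomial.monic_X_pow_sub_C _ two_ne_zero).leadingCoeff]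
    exact not_dvd_of_eval_ne_zero_mv Fc hF₃ev (hpt 1) (by simp)
  have hbot : ¬ F₃ ∣ G.coeff 0 := by
    rw [hG, Polynomial.coeff_sub, Polynomial.coeff_X_pow, Polynomial.coeff_C_zero, if_neg (by norm_num),
      zero_sub]
    refine not_dvd_of_eval_ne_zero_mv Fc hF₃ev (hpt 1) ?_
    simp
  have hdisc : ¬ F₃ ∣ Polynomial.resultant G (derivative G) G.natDegree (G.natDegree - 1) := by
    rw [Polynomial.resultant_deriv (by rw [hGdeg]; exact two_pos), Polynomial.discr_of_degree_eq_two hGdeg,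
      hGnat, hG, (Polynomial.monic_X_pow_sub_C _ two_ne_zero).leadingCoeff]
    refine not_dvd_of_eval_ne_zero_mv Fc hF₃ev (hpt 1) ?_
    simp only [Polynomial.coeff_sub, Polynomial.coeff_X_pow, Polynomial.coeff_C]
    norm_num
    simp
  refine unprojectedDense_relation_of_topRowRoot Fc conicE_irreducible (by rw [conicE_natDegree]) 1
    (fun j => ?_) (X + 1) (fun j => ?_) (Polynomial.X_add_C_ne_zero 1) (θ := -1) (by simp) F₃ hF₃ev G
    (by rw [hGnat]; norm_num) htop hbot hdisc 1
    (fun h => htop (by rw [hG, (Polynomial.monic_X_pow_sub_C _ two_ne_zero).leadingCoeff]; exact h))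
    hS hdim ?_
  · rw [conicE_coeff]; split_ifs <;> simp
  · rw [conicE_coeff, Polynomial.coeff_add, Polynomial.coeff_X, Polynomial.coeff_one]
    rcases j with _ | _ | _ | j <;> simp [Polynomial.coeff_one]
  · intro x₀ x₁ y hF _ _ hGy
    refine hsub x₀ x₁ y ?_ ?_
    · rw [conicE_eval] at hF; exact hF
    · rw [hGev] at hGy
      have : (MvPolynomial.eval ![x₀, x₁, Complex.exp x₁]) (MvPolynomial.X 2 + MvPolynomial.X 0) =
          Complex.exp x₁ + x₀ := by simp
      rw [this] at hGy
      exact sub_eq_zero.1 hGy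

end RelationBoundedPlace

end Summit.Schanuel.Schanuel.Theorems
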